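import Summits.QuantumFields.YangMills.Theorems.SwapVirialDeficitZeroModeGroupThreeScaling
import HarnessLib

/-!
# Exact zero-mode rung Z4 in SMALL-BALL form, three letters — I: the commutator small ball `N₃(t) ⊆ SU(2)³` in the cone model,
# hub Tonelli and axis reduction
# (LEAD ym-line-sfw-p2 g93 07:46Z «the zero-mode inputs a sharp law needs next are EXACT small-ball asymptotics
# `Haar³{N₃(t)} = v₃t⁴(1+O(t^θ))`»; fcl-p3 g43's plan memo Z4; free-hands support of ⟨stmt-QuantumFields-24197⟩)

The SMALL-BALL twin of w2 g55's Laplace-form files ✓`SwapVirialDeficitZeroModeGroupThree{Ball,Axis,Scaling}` (whose cone model, hub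
Tonelli ✓`lintegral_pi_three_eq_hub`, conjugation invariance ✓`measurePreserving_conjIso_prod` / ✓`commSq_conj` / ✓`conj_unitConeQ_self` and
transverse dilation ✓`dilate` are consumed BY NAME): the EVENT `N₃(t) = {C ∈ SU(2)³ | ‖[q₀,q₁]‖ ≤ t, ‖[q₀,q₂]‖ ≤ t, ‖[q₁,q₂]‖ ≤ t}`
(`q_μ = su2Quat (C μ)`) instead of the weight `e^{−β·block}`.
* §1 `tripleBall t`, `conePairSet t a` (the cone-model section at hub `a`), `phiCone t a` (its `cone ⊗ cone` mass), `dilNormSq s x =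
  x₀² + x_I² + s(x_J² + x_K²)` and `rescaledSet s a` (the section after the transverse blow-up `D_√s`, multiplied out — no divisions; used in part II);
* §2 ★ `haar_tripleBall_eq_cone`, ★ `haar_tripleBall_eq_lintegral_phiCone` — `Haar³(N₃(t)) = ∫ φ_t(a) dcone(a)` (cone model + hub Tonelli);
* §3 ★ `phiCone_eq_axis` — `φ_t(a) = φ_t(re a + ‖Im a‖·i)` off a null set, ★ `haar_tripleBall_eq_lintegral_axis`.
Part II (`…SmallBallScaling`): the EXACT `t⁴`-scaling `φ_t(a) = coneConst²·t⁴·∫∫𝟙_{rescaledSet t² a}`; parts III–IV: null boundaries, domination by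
`e³·`(w2's dominator), dominated convergence ⇒ `Haar³(N₃(t))/t⁴ → v₃′ > 0`.
HONEST LABEL: finite-dimensional measure theory on `SU(2)³` (plan-level zero-mode rung of a DRAFT line); NOT the fixed-`L` sharp law of `F^S`, NOT
⟨24197⟩; the Yang–Mills mass gap is NOT proved; no summit is proved by a line.  Seat ym-line-fcl-p3 g44 (cell ym-idea-1, free hands),
`--supports stmt-QuantumFields-24197`.  Definitions + theorems, 0 `sorry`, standard axioms; the three local instances of the ToronLog files.
References: [cite: GonzalezarroyoAltes1988]; [cite: Vanbaal2001]; [folklore].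
-/

set_option autoImplicit false

noncomputable section

open MeasureTheory Quaternion Set
open scoped Quaternion ENNReal BigOperators
open Literature.MathematicalPhysics.QuantumLattice
open Literature.MathematicalPhysics.QuantumFieldTheory (haarProbability)
open Literature.MathematicalPhysics.QuantumFieldTheory.Balaban1983to89.T4HaarSU2Translate (su2Quat_quatToSU2 measurable_su2Quat)
open Summit.QuantumFields.YangMills.Theorems.SwapTwistDeficit.ToronLog

attribute [local instance] Literature.Analysis.FluidPDE.Tao2016.quatMeasurableSpace
  Literature.Analysis.FluidPDE.Tao2016.quatBorelSpace
  Literature.MathematicalPhysics.QuantumLattice.secondCountableTopology_su2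

namespace Summit.QuantumFields.YangMills.Theorems.SwapVirialDeficit.ZeroModeGroup

/-! ## §1 The events -/

/-- ★ **The three-letter commutator small ball** `N₃(t) = {C ∈ SU(2)³ | ‖[q₀,q₁]‖ ≤ t ∧ ‖[q₀,q₂]‖ ≤ t ∧ ‖[q₁,q₂]‖ ≤ t}`, `q_μ = su2Quat (C μ)`.
[cite: GonzalezarroyoAltes1988] [cite: Vanbaal2001] -/
def tripleBall (t : ℝ) : Set (Fin 3 → Matrix.specialUnitaryGroup (Fin 2) ℂ) :=
  {C | ‖su2Quat (C 0) * su2Quat (C 1) - su2Quat (C 1) * su2Quat (C 0)‖ ≤ t ∧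
    ‖su2Quat (C 0) * su2Quat (C 2) - su2Quat (C 2) * su2Quat (C 0)‖ ≤ t ∧
    ‖su2Quat (C 1) * su2Quat (C 2) - su2Quat (C 2) * su2Quat (C 1)‖ ≤ t}

/-- The cone-model section of `N₃(t)` at hub `a`: pairs `(x, y)` with `commSq x y ≤ t²`, `commSq x a ≤ t²`, `commSq y a ≤ t²`. [folklore] -/
def conePairSet (t : ℝ) (a : ℍ) : Set (ℍ × ℍ) :=
  {p | commSq p.1 p.2 ≤ t ^ 2 ∧ commSq p.1 a ≤ t ^ 2 ∧ commSq p.2 a ≤ t ^ 2}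

/-- Its `cone ⊗ cone` mass `φ_t(a)`. [folklore] -/
def phiCone (t : ℝ) (a : ℍ) : ℝ≥0∞ := (coneMeasure.prod coneMeasure) (conePairSet t a)

/-- The dilated norm square `N_s(x) = x₀² + x_I² + s·(x_J² + x_K²) = ‖D_√s x‖²`. [folklore] -/
def dilNormSq (s : ℝ) (x : ℍ) : ℝ := x.re ^ 2 + x.imI ^ 2 + s * (x.imJ ^ 2 + x.imK ^ 2)

/-- ★ **The rescaled section** `G_s(a)` at an axis hub `a = a₀ + a_I·i` (`s = t²`; multiplied out, no divisions): `N_s(x) < 1`, `N_s(y) < 1`,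
`4a_I²(x_J²+x_K²) ≤ N_s(x)‖a‖²`, `4a_I²(y_J²+y_K²) ≤ N_s(y)‖a‖²`, `4[(x_Ky_I − x_Iy_K)² + (x_Iy_J − x_Jy_I)² + s(x_Jy_K − x_Ky_J)²] ≤ N_s(x)N_s(y)`.
[folklore] -/
def rescaledSet (s : ℝ) (a : ℍ) : Set (ℍ × ℍ) :=
  {p | dilNormSq s p.1 < 1 ∧ dilNormSq s p.2 < 1 ∧
    4 * (a.imI ^ 2 * (p.1.imJ ^ 2 + p.1.imK ^ 2)) ≤ dilNormSq s p.1 * ‖a‖ ^ 2 ∧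
    4 * (a.imI ^ 2 * (p.2.imJ ^ 2 + p.2.imK ^ 2)) ≤ dilNormSq s p.2 * ‖a‖ ^ 2 ∧
    4 * ((p.1.imK * p.2.imI - p.1.imI * p.2.imK) ^ 2 + (p.1.imI * p.2.imJ - p.1.imJ * p.2.imI) ^ 2 +
        s * (p.1.imJ * p.2.imK - p.1.imK * p.2.imJ) ^ 2) ≤ dilNormSq s p.1 * dilNormSq s p.2}

/-- `dilNormSq s x = ‖D_√s x‖²` for `s ≥ 0`; here in the form `dilNormSq (t²) x = ‖D_t x‖²`. [folklore] -/
theorem dilNormSq_sq_eq (t : ℝ) (x : ℍ) : dilNormSq (t ^ 2) x = ‖dilate t x‖ ^ 2 := by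
  rw [norm_sq_dilate, dilNormSq]

/-- `dilNormSq 0 x = x₀² + x_I²`. [folklore] -/
theorem dilNormSq_zero (x : ℍ) : dilNormSq 0 x = x.re ^ 2 + x.imI ^ 2 := by
  rw [dilNormSq, zero_mul, add_zero]

/-- `dilNormSq` is continuous in the point. [folklore] -/
theorem continuous_dilNormSq (s : ℝ) : Continuous (dilNormSq s) := by
  unfold dilNormSq
  exact ((Quaternion.continuous_re.pow 2).add (Quaternion.continuous_imI.pow 2)).add
    (continuous_const.mul ((Quaternion.continuous_imJ.pow 2).add (Quaternion.continuous_imK.pow 2)))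

/-- If `dilNormSq s x = 0` with `s > 0` then all coordinates of `x` vanish. [folklore] -/
theorem coords_eq_zero_of_dilNormSq_eq_zero {s : ℝ} (hs : 0 < s) {x : ℍ} (h : dilNormSq s x = 0) :
    x.re = 0 ∧ x.imI = 0 ∧ x.imJ = 0 ∧ x.imK = 0 := by
  unfold dilNormSq at h
  have hJ2 : 0 ≤ s * x.imJ ^ 2 := by positivity
  have hK2 : 0 ≤ s * x.imK ^ 2 := by positivity
  have h1 : x.re ^ 2 = 0 := by nlinarith [sq_nonneg x.re, sq_nonneg x.imI]
  have h2 : x.imI ^ 2 = 0 := by nlinarith [sq_nonneg x.re, sq_nonneg x.imI]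
  have h3 : s * x.imJ ^ 2 = 0 := by nlinarith [sq_nonneg x.re, sq_nonneg x.imI]
  have h4 : s * x.imK ^ 2 = 0 := by nlinarith [sq_nonneg x.re, sq_nonneg x.imI]
  exact ⟨(pow_eq_zero_iff two_ne_zero).1 h1, (pow_eq_zero_iff two_ne_zero).1 h2,
    (pow_eq_zero_iff two_ne_zero).1 ((mul_eq_zero.1 h3).resolve_left hs.ne'),
    (pow_eq_zero_iff two_ne_zero).1 ((mul_eq_zero.1 h4).resolve_left hs.ne')⟩

/-- Coordinate measurability on `ℍ × ℍ` (first letter). [folklore] -/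
theorem measurable_coords_fst :
    (Measurable fun p : ℍ × ℍ => p.1.imI) ∧ (Measurable fun p : ℍ × ℍ => p.1.imJ) ∧ (Measurable fun p : ℍ × ℍ => p.1.imK) :=
  ⟨Quaternion.continuous_imI.measurable.comp measurable_fst, Quaternion.continuous_imJ.measurable.comp measurable_fst,
    Quaternion.continuous_imK.measurable.comp measurable_fst⟩

/-- Coordinate measurability on `ℍ × ℍ` (second letter). [folklore] -/
theorem measurable_coords_snd :
    (Measurable fun p : ℍ × ℍ => p.2.imI) ∧ (Measurable fun p : ℍ × ℍ => p.2.imJ) ∧ (Measurable fun p : ℍ × ℍ => p.2.imK) :=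
  ⟨Quaternion.continuous_imI.measurable.comp measurable_snd, Quaternion.continuous_imJ.measurable.comp measurable_snd,
    Quaternion.continuous_imK.measurable.comp measurable_snd⟩

/-- `dilNormSq s x ≥ 0` for `s ≥ 0`. [folklore] -/
theorem dilNormSq_nonneg {s : ℝ} (hs : 0 ≤ s) (x : ℍ) : 0 ≤ dilNormSq s x := by
  unfold dilNormSq; positivity

/-- The triple small ball is measurable. [folklore] -/
theorem measurableSet_tripleBall (t : ℝ) : MeasurableSet (tripleBall t) := by
  have hq : ∀ μ : Fin 3, Measurable fun C : Fin 3 → Matrix.specialUnitaryGroup (Fin 2) ℂ => su2Quat (C μ) :=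
    fun μ => measurable_su2Quat.comp (measurable_pi_apply μ)
  have h : ∀ μ ν : Fin 3, MeasurableSet {C : Fin 3 → Matrix.specialUnitaryGroup (Fin 2) ℂ |
      ‖su2Quat (C μ) * su2Quat (C ν) - su2Quat (C ν) * su2Quat (C μ)‖ ≤ t} :=
    fun μ ν => measurableSet_le (((hq μ).mul (hq ν)).sub ((hq ν).mul (hq μ))).norm measurable_const
  exact (h 0 1).inter ((h 0 2).inter (h 1 2))

/-- The cone-model triple event `(x, y, a) ↦ [commSq x y ≤ t² ∧ commSq x a ≤ t² ∧ commSq y a ≤ t²]` is measurable on `ℍ × ℍ × ℍ`. [folklore] -/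
theorem measurableSet_coneTriple (t : ℝ) :
    MeasurableSet {p : ℍ × ℍ × ℍ | commSq p.1 p.2.1 ≤ t ^ 2 ∧ commSq p.1 p.2.2 ≤ t ^ 2 ∧ commSq p.2.1 p.2.2 ≤ t ^ 2} := by
  have h1 : Measurable fun p : ℍ × ℍ × ℍ => commSq p.1 p.2.1 :=
    measurable_commSq.comp (measurable_fst.prodMk (measurable_fst.comp measurable_snd))
  have h2 : Measurable fun p : ℍ × ℍ × ℍ => commSq p.1 p.2.2 :=
    measurable_commSq.comp (measurable_fst.prodMk (measurable_snd.comp measurable_snd))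
  have h3 : Measurable fun p : ℍ × ℍ × ℍ => commSq p.2.1 p.2.2 :=
    measurable_commSq.comp ((measurable_fst.comp measurable_snd).prodMk (measurable_snd.comp measurable_snd))
  exact (measurableSet_le h1 measurable_const).inter ((measurableSet_le h2 measurable_const).inter (measurableSet_le h3 measurable_const))

/-- The section `conePairSet t a` is measurable. [folklore] -/
theorem measurableSet_conePairSet (t : ℝ) (a : ℍ) : MeasurableSet (conePairSet t a) := by
  have h1 : Measurable fun p : ℍ × ℍ => commSq p.1 p.2 := measurable_commSq
  have h2 : Measurable fun p : ℍ × ℍ => commSq p.1 a := measurable_commSq.comp (measurable_fst.prodMk measurable_const)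
  have h3 : Measurable fun p : ℍ × ℍ => commSq p.2 a := measurable_commSq.comp (measurable_snd.prodMk measurable_const)
  exact (measurableSet_le h1 measurable_const).inter ((measurableSet_le h2 measurable_const).inter (measurableSet_le h3 measurable_const))

/-- The rescaled section is measurable. [folklore] -/
theorem measurableSet_rescaledSet (s : ℝ) (a : ℍ) : MeasurableSet (rescaledSet s a) := by
  have hN1 : Measurable fun p : ℍ × ℍ => dilNormSq s p.1 := (continuous_dilNormSq s).measurable.comp measurable_fst
  have hN2 : Measurable fun p : ℍ × ℍ => dilNormSq s p.2 := (continuous_dilNormSq s).measurable.comp measurable_snd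
  obtain ⟨hI1, hJ1, hK1⟩ := measurable_coords_fst
  obtain ⟨hI2, hJ2, hK2⟩ := measurable_coords_snd
  have hc1 : Measurable fun p : ℍ × ℍ => 4 * (a.imI ^ 2 * (p.1.imJ ^ 2 + p.1.imK ^ 2)) :=
    (((hJ1.pow_const 2).add (hK1.pow_const 2)).const_mul _).const_mul _
  have hc2 : Measurable fun p : ℍ × ℍ => 4 * (a.imI ^ 2 * (p.2.imJ ^ 2 + p.2.imK ^ 2)) :=
    (((hJ2.pow_const 2).add (hK2.pow_const 2)).const_mul _).const_mul _
  have hc3 : Measurable fun p : ℍ × ℍ => 4 * ((p.1.imK * p.2.imI - p.1.imI * p.2.imK) ^ 2 + (p.1.imI * p.2.imJ - p.1.imJ * p.2.imI) ^ 2 +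
      s * (p.1.imJ * p.2.imK - p.1.imK * p.2.imJ) ^ 2) :=
    (((((hK1.mul hI2).sub (hI1.mul hK2)).pow_const 2).add (((hI1.mul hJ2).sub (hJ1.mul hI2)).pow_const 2)).add
      ((((hJ1.mul hK2).sub (hK1.mul hJ2)).pow_const 2).const_mul s)).const_mul _
  unfold rescaledSet
  exact (measurableSet_lt hN1 measurable_const).inter ((measurableSet_lt hN2 measurable_const).inter
    ((measurableSet_le hc1 (hN1.mul measurable_const)).inter ((measurableSet_le hc2 (hN2.mul measurable_const)).inter
      (measurableSet_le hc3 (hN1.mul hN2)))))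

/-! ## §2 Haar³ to cone³ and the hub -/

/-- `‖·‖ ≤ t ↔ ‖·‖² ≤ t²` for `t ≥ 0`. [folklore] -/
theorem norm_le_iff_sq_le {z : ℍ} {t : ℝ} (ht : 0 ≤ t) : ‖z‖ ≤ t ↔ ‖z‖ ^ 2 ≤ t ^ 2 :=
  (sq_le_sq₀ (norm_nonneg _) ht).symm

/-- ★ **`Haar³(N₃(t))` in the cone model**: `= cone³{x | commSq(x₀,x₁) ≤ t², commSq(x₀,x₂) ≤ t², commSq(x₁,x₂) ≤ t²}` (`t ≥ 0`). [folklore] -/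
theorem haar_tripleBall_eq_cone {t : ℝ} (ht : 0 ≤ t) :
    (Measure.pi fun _ : Fin 3 => haarProbability (Matrix.specialUnitaryGroup (Fin 2) ℂ)) (tripleBall t) =
      (Measure.pi fun _ : Fin 3 => coneMeasure)
        {x : Fin 3 → ℍ | commSq (x 0) (x 1) ≤ t ^ 2 ∧ commSq (x 0) (x 2) ≤ t ^ 2 ∧ commSq (x 1) (x 2) ≤ t ^ 2} := by
  haveI := isProbabilityMeasure_coneMeasure
  rw [← NearlyCommutingThree.measurePreserving_proj_three.measure_preimage (measurableSet_tripleBall t).nullMeasurableSet]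
  refine measure_congr ?_
  filter_upwards [ae_ne_zero_pi_three] with x hx
  simp only [eq_iff_iff]
  change (fun μ => quatToSU2 (x μ)) ∈ tripleBall t ↔ commSq (x 0) (x 1) ≤ t ^ 2 ∧ commSq (x 0) (x 2) ≤ t ^ 2 ∧ commSq (x 1) (x 2) ≤ t ^ 2
  simp only [tripleBall, Set.mem_setOf_eq]
  rw [norm_le_iff_sq_le ht, norm_le_iff_sq_le ht, norm_le_iff_sq_le ht, norm_comm_su2Quat_quatToSU2_sq (hx 0) (hx 1),
    norm_comm_su2Quat_quatToSU2_sq (hx 0) (hx 2), norm_comm_su2Quat_quatToSU2_sq (hx 1) (hx 2)]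

/-- ★ **Hub Tonelli**: `Haar³(N₃(t)) = ∫ φ_t(a) dcone(a)` (`t ≥ 0`), the third letter as hub. [folklore] -/
theorem haar_tripleBall_eq_lintegral_phiCone {t : ℝ} (ht : 0 ≤ t) :
    (Measure.pi fun _ : Fin 3 => haarProbability (Matrix.specialUnitaryGroup (Fin 2) ℂ)) (tripleBall t) = ∫⁻ a, phiCone t a ∂coneMeasure := by
  haveI := isProbabilityMeasure_coneMeasure
  rw [haar_tripleBall_eq_cone ht]
  set S : Set (ℍ × ℍ × ℍ) := {p | commSq p.1 p.2.1 ≤ t ^ 2 ∧ commSq p.1 p.2.2 ≤ t ^ 2 ∧ commSq p.2.1 p.2.2 ≤ t ^ 2} with hS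
  have hSm : MeasurableSet S := measurableSet_coneTriple t
  have hpre : {x : Fin 3 → ℍ | commSq (x 0) (x 1) ≤ t ^ 2 ∧ commSq (x 0) (x 2) ≤ t ^ 2 ∧ commSq (x 1) (x 2) ≤ t ^ 2} =
      (fun x : Fin 3 → ℍ => (x 0, x 1, x 2)) ⁻¹' S := rfl
  have hmeas : Measurable fun x : Fin 3 → ℍ => (x 0, x 1, x 2) :=
    (measurable_pi_apply 0).prodMk ((measurable_pi_apply 1).prodMk (measurable_pi_apply 2))
  rw [hpre, ← lintegral_indicator_one (hSm.preimage hmeas)]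
  have e1 : (fun x : Fin 3 → ℍ => ((fun x : Fin 3 → ℍ => (x 0, x 1, x 2)) ⁻¹' S).indicator (1 : (Fin 3 → ℍ) → ℝ≥0∞) x) =
      fun x : Fin 3 → ℍ => S.indicator 1 (x 0, x 1, x 2) := by
    funext x; rfl
  rw [e1, lintegral_pi_three_eq_hub (S.indicator 1) (measurable_one.indicator hSm)]
  refine lintegral_congr fun a => ?_
  rw [phiCone, ← lintegral_indicator_one (measurableSet_conePairSet t a)]
  refine lintegral_congr fun p => ?_
  simp only [Set.indicator, hS, conePairSet, Set.mem_setOf_eq, Pi.one_apply]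

/-! ## §3 Straightening the hub -/

/-- ★ **`φ_t(a) = φ_t(axisPoint a)`** whenever `q(a) ≠ 0`: both inner letters are rotated by the straightening conjugation, which preserves
`cone ⊗ cone` (✓`measurePreserving_conjIso_prod`) and every `commSq` (✓`commSq_conj`), and sends `a` to `re a + ‖Im a‖·i`
(✓`conj_unitConeQ_self`). [folklore] -/
theorem phiCone_eq_axis (t : ℝ) {a : ℍ} (ha : coneQ a ≠ 0) : phiCone t a = phiCone t (axisPoint a) := by
  haveI := isProbabilityMeasure_coneMeasure
  set u : ℍ := ‖coneQ a‖⁻¹ • coneQ a with hu_def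
  have hu : ‖u‖ = 1 := norm_unitConeQ ha
  have hP := measurePreserving_conjIso_prod u hu
  have hpre : conePairSet t a = (Prod.map (conjIso u hu) (conjIso u hu)) ⁻¹' conePairSet t (axisPoint a) := by
    ext p
    simp only [conePairSet, Set.mem_setOf_eq, Set.mem_preimage, Prod.map_fst, Prod.map_snd, conjIso_apply]
    rw [← conj_unitConeQ_self ha, commSq_conj hu, commSq_conj hu, commSq_conj hu]
  rw [phiCone, phiCone, hpre, hP.measure_preimage (measurableSet_conePairSet t _).nullMeasurableSet]

/-- ★ **`Haar³(N₃(t)) = ∫ φ_t(re a + ‖Im a‖·i) dcone(a)`** (`t ≥ 0`). [folklore] -/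
theorem haar_tripleBall_eq_lintegral_axis {t : ℝ} (ht : 0 ≤ t) :
    (Measure.pi fun _ : Fin 3 => haarProbability (Matrix.specialUnitaryGroup (Fin 2) ℂ)) (tripleBall t) =
      ∫⁻ a, phiCone t (axisPoint a) ∂coneMeasure := by
  rw [haar_tripleBall_eq_lintegral_phiCone ht]
  refine lintegral_congr_ae ?_
  filter_upwards [ae_coneQ_ne_zero] with a ha using phiCone_eq_axis t ha

end Summit.QuantumFields.YangMills.Theorems.SwapVirialDeficit.ZeroModeGroup

end
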